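import Mathlib.LinearAlgebra.Dual.Lemmas
import Literature.AlgebraicTopology.SingularHomology.UniversalCoefficientsField
import HarnessLib

/-!
# Over a field, `f^*` on `Hⁿ` is the transpose of `f_*` on `Hₙ`: injectivity, surjectivity and
invertibility of induced maps

A. Hatcher, *Algebraic Topology* (2002), §3.1: for a field `F` the Kronecker map
`h : Hⁿ(X; F) → Hom_F(Hₙ(X; F), F)` is an isomorphism (Thm. 3.2 with p. 198, in the tree
`kroneckerPairing_bijective_of_field`, file `UniversalCoefficientsField.lean`) and it is natural,
`h_X ∘ f^* = (f_*)ᵀ ∘ h_Y` (p. 201, in the tree `kroneckerPairing_comp_cohomologyMap`, file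
`UniversalCoefficients.lean`). Hence, "with field coefficients, cohomology is the exact dual of
homology" also on MAPS: for every continuous `f : X → Y` and every `n`,

* `singularCohomology_map_injective_iff_of_field`: `f^* : Hⁿ(Y; F) → Hⁿ(X; F)` is injective iff
  `f_* : Hₙ(X; F) → Hₙ(Y; F)` is surjective;
* `singularCohomology_map_surjective_iff_of_field`: `f^*` is surjective iff `f_*` is injective;
* `singularCohomology_map_bijective_iff_of_field`, `isIso_singularCohomology_map_iff_of_field`:
  `f^*` is bijective (an isomorphism in `ModuleCat F`) iff `f_*` is bijective.

(Mathlib: `LinearMap.dualMap_injective_iff`, `dualMap_surjective_iff` for vector spaces of any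
dimension.) This is the form in which statements about `H¹(-; ℚ)` of complex algebraic varieties
(e.g. `Literature.AlgebraicGeometry.Motives.isIso_bettiCohomology_map_abelJacobi`,
`(f^P)^* : H¹(J(ℂ); ℚ) ≅ H¹(C(ℂ); ℚ)`) are reduced to statements about `H₁`, hence about
fundamental groups. Everything is proved; no definitions.

## References

* A. Hatcher, *Algebraic Topology*, CUP 2002, §3.1 Thm. 3.2 (p. 195), p. 198 (field
  coefficients), p. 201 (naturality of `h`). [HatcherAT2002]
-/

noncomputable section

open CategoryTheory

universe u v

namespace Literature.AlgebraicTopology.SingularHomology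

variable (F : Type v) [Field F] {X Y : Type u} [TopologicalSpace X] [TopologicalSpace Y]
  (f : C(X, Y)) (n : ℕ)

/-- Over a field, `f^*` on `Hⁿ` is conjugate to the transpose of `f_*` on `Hₙ` by the (bijective,
natural) Kronecker maps: `f^* = h_X⁻¹ ∘ (f_*)ᵀ ∘ h_Y` (Hatcher 2002, §3.1 pp. 198, 201).
[cite: HatcherAT2002, §3.1 Thm. 3.2 (p. 195) and p. 201] -/
theorem singularCohomology_map_eq_conj_dualMap_of_field :
    ((singularCohomology.map F F f n).hom : singularCohomology F F Y n →ₗ[F] _) =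
      ((LinearEquiv.ofBijective _ (kroneckerPairing_bijective_of_field F X n)).symm.toLinearMap.comp
        (singularHomology.map F F f n).hom.dualMap).comp
        (LinearEquiv.ofBijective _ (kroneckerPairing_bijective_of_field F Y n)).toLinearMap := by
  apply LinearMap.ext
  intro a
  apply (LinearEquiv.ofBijective _ (kroneckerPairing_bijective_of_field F X n)).injective
  simp only [LinearMap.coe_comp, LinearEquiv.coe_coe, Function.comp_apply,
    LinearEquiv.apply_symm_apply, LinearEquiv.ofBijective_apply]
  exact LinearMap.congr_fun (kroneckerPairing_comp_cohomologyMap (R := F) f n) a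

/-- **`f^* : Hⁿ(Y; F) → Hⁿ(X; F)` is injective iff `f_* : Hₙ(X; F) → Hₙ(Y; F)` is surjective**,
for a field `F`, every continuous `f` and every `n` (Hatcher 2002, §3.1: `Hⁿ(-; F) = Hom(Hₙ(-; F), F)`
naturally; a linear map of vector spaces is surjective iff its transpose is injective).
[cite: HatcherAT2002, §3.1 Thm. 3.2 (p. 195) and p. 201] -/
theorem singularCohomology_map_injective_iff_of_field :
    Function.Injective (singularCohomology.map F F f n) ↔
      Function.Surjective (singularHomology.map F F f n) := by
  rw [← LinearMap.dualMap_injective_iff]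
  change Function.Injective (singularCohomology.map F F f n).hom ↔
    Function.Injective (singularHomology.map F F f n).hom.dualMap
  rw [singularCohomology_map_eq_conj_dualMap_of_field F f n, LinearMap.coe_comp, LinearMap.coe_comp,
    LinearEquiv.coe_coe, LinearEquiv.coe_coe,
    Function.Injective.of_comp_iff' _ (LinearEquiv.bijective _), (LinearEquiv.injective _).of_comp_iff]

/-- **`f^* : Hⁿ(Y; F) → Hⁿ(X; F)` is surjective iff `f_* : Hₙ(X; F) → Hₙ(Y; F)` is injective**,
for a field `F` (Hatcher 2002, §3.1; a linear map of vector spaces is injective iff its transpose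
is surjective). [cite: HatcherAT2002, §3.1 Thm. 3.2 (p. 195) and p. 201] -/
theorem singularCohomology_map_surjective_iff_of_field :
    Function.Surjective (singularCohomology.map F F f n) ↔
      Function.Injective (singularHomology.map F F f n) := by
  rw [← LinearMap.dualMap_surjective_iff]
  change Function.Surjective (singularCohomology.map F F f n).hom ↔
    Function.Surjective (singularHomology.map F F f n).hom.dualMap
  rw [singularCohomology_map_eq_conj_dualMap_of_field F f n, LinearMap.coe_comp, LinearMap.coe_comp,
    LinearEquiv.coe_coe, LinearEquiv.coe_coe,
    Function.Surjective.of_comp_iff _ (LinearEquiv.surjective _),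
    Function.Surjective.of_comp_iff' (LinearEquiv.bijective _)]

/-- **`f^*` on `Hⁿ(-; F)` is bijective iff `f_*` on `Hₙ(-; F)` is**, for a field `F`
(Hatcher 2002, §3.1). [cite: HatcherAT2002, §3.1 Thm. 3.2 (p. 195) and p. 201] -/
theorem singularCohomology_map_bijective_iff_of_field :
    Function.Bijective (singularCohomology.map F F f n) ↔
      Function.Bijective (singularHomology.map F F f n) := by
  rw [Function.Bijective, Function.Bijective, singularCohomology_map_injective_iff_of_field,
    singularCohomology_map_surjective_iff_of_field, and_comm]

/-- **`f^* : Hⁿ(Y; F) ⟶ Hⁿ(X; F)` is an isomorphism (in `ModuleCat F`) iff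
`f_* : Hₙ(X; F) → Hₙ(Y; F)` is bijective**, for a field `F` (Hatcher 2002, §3.1).
[cite: HatcherAT2002, §3.1 Thm. 3.2 (p. 195) and p. 201] -/
theorem isIso_singularCohomology_map_iff_of_field :
    IsIso (singularCohomology.map F F f n) ↔ Function.Bijective (singularHomology.map F F f n) := by
  rw [← singularCohomology_map_bijective_iff_of_field]
  constructor
  · intro h
    exact ((forget (ModuleCat F)).mapIso (asIso (singularCohomology.map F F f n))).toEquiv.bijective
  · intro h
    exact (LinearEquiv.ofBijective (singularCohomology.map F F f n).hom h).toModuleIso.isIso_hom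

end Literature.AlgebraicTopology.SingularHomology

end
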